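import Mathlib.Data.Real.Basic
import Mathlib.Data.Rat.Cast.Order
import HarnessLib

/-!
# Chains of sub-intervals for piecewise certificates

A property of a real variable certified box by box on consecutive rational sub-intervals
`[a, t₁], [t₁, t₂], …, [tₙ, b]` holds on `[a, b]` (`forall_of_chainHolds`). This is the glue
between the sub-box lists produced by the branch-and-bound certification of the `γ = 5/3`
barriers (as in the interval-arithmetic proofs of Buckmaster–Cao-Labora–Gómez-Serrano, App. B,
where each inequality is validated on a subdivision of its parameter interval) and the
statements "for all `u ∈ [0, 1]`" used by the barrier lemmas.

[cite: BuckmasterCaolaboraGomezserrano2025, Appendix B]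
-/

namespace Literature.Analysis.FluidPDE

namespace BuckmasterCaolaboraGomezserrano2025

namespace Monatomic

namespace Cert

/-- `ChainHolds P a [t₁, …, tₙ] b`: `P` holds on each of `[a, t₁]`, `[t₁, t₂]`, …, `[tₙ, b]`
(real variable, rational breakpoints). [folklore] -/
def ChainHolds (P : ℝ → Prop) (a : ℚ) : List ℚ → ℚ → Prop
  | [], b => ∀ u : ℝ, ((a : ℚ) : ℝ) ≤ u → u ≤ ((b : ℚ) : ℝ) → P u
  | t :: ts, b => (∀ u : ℝ, ((a : ℚ) : ℝ) ≤ u → u ≤ ((t : ℚ) : ℝ) → P u) ∧ ChainHolds P t ts b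

/-- [folklore] -/
theorem chainHolds_nil (P : ℝ → Prop) (a b : ℚ) :
    ChainHolds P a [] b = ∀ u : ℝ, ((a : ℚ) : ℝ) ≤ u → u ≤ ((b : ℚ) : ℝ) → P u := rfl

/-- [folklore] -/
theorem chainHolds_cons (P : ℝ → Prop) (a t b : ℚ) (ts : List ℚ) :
    ChainHolds P a (t :: ts) b =
      ((∀ u : ℝ, ((a : ℚ) : ℝ) ≤ u → u ≤ ((t : ℚ) : ℝ) → P u) ∧ ChainHolds P t ts b) := rfl

/-- **Gluing a chain of boxes.** [folklore] -/
theorem forall_of_chainHolds {P : ℝ → Prop} :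
    ∀ (ts : List ℚ) (a b : ℚ), ChainHolds P a ts b →
      ∀ u : ℝ, ((a : ℚ) : ℝ) ≤ u → u ≤ ((b : ℚ) : ℝ) → P u
  | [], _, _, h, u, h1, h2 => h u h1 h2
  | t :: ts, _, b, h, u, h1, h2 => by
    rw [chainHolds_cons] at h
    by_cases hu : u ≤ ((t : ℚ) : ℝ)
    · exact h.1 u h1 hu
    · exact forall_of_chainHolds ts t b h.2 u (le_of_lt (not_le.mp hu)) h2

end Cert

end Monatomic

end BuckmasterCaolaboraGomezserrano2025

end Literature.Analysis.FluidPDE
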